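import Mathlib
import Literature.Combinatorics.Optimization.CorrelationPolytopePsdRank

/-!
# Pattern matrices: psd rank versus sum-of-squares degree (Lee–Raghavendra–Steurer 2015, Thm. 3.8)

Companion of `CorrelationPolytopePsdRank.lean` (same directory), which records LRS Theorem 1.1 =
5.4 (`rk_psd(CORR_n) ≥ 2^{α n^{2/13}}`) as the named fact `LeeRaghavendraSteurer2015_thm11` and
says in its docstring that the ENGINE of that bound — "sum-of-squares degree of Grigoriev's knapsack
tautologies ⇒ psd rank of pattern matrices, LRS Thm 3.8" — "is far beyond this file". This file
types that engine as a cited NAMED FACT (not proved here), with the (few, elementary) definitions it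
needs, so that routes can refer to the general pattern-matrix theorem and not only to its
correlation-polytope corollary.

Source: J. R. Lee, P. Raghavendra, D. Steurer, *Lower bounds on the size of semidefinite programming
relaxations*, STOC 2015, 567–576 (arXiv:1411.6317) [LeeRaghavendraSteurer2015]; held text
`paper:arxiv-1411.6317` (arXiv TeX source; locators below are theorem numbers of that version).

Printed statements (verbatim).
* §1 ("Main theorem"): "For a function `f : {0,1}^m → ℝ_{≥0}` and a number `n ≥ m`, we define the
  following central object: The `C(n,m) × 2ⁿ`-dimensional real matrix `M_n^f` is given by
  `M_n^f(S,x) := f(x_S)`, where `S ⊆ [n]` runs over all subsets of size `m` and `x ∈ {0,1}ⁿ`"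
  [`x_S = (x_{i_1}, …, x_{i_m})`, `i_1 < ⋯ < i_m` the elements of `S`] — `patternMatrix` below.
* Def. 1.7: a rank-`r` psd factorisation of a nonnegative matrix `M` is `M_{ij} = Tr(A_i B_j)` with
  `A_i, B_j ∈ 𝕊^r_+`; `rk_psd(M)` = least such `r` — `HasPsdFactorization M r` below (so
  "`rk_psd(M) ≥ R`" reads "no psd factorisation of size `r` for `r < R`").
* §2: "the sos degree of a function is larger than `d` if and only if there exists a degree-`d`
  pseudo-density `D` with `E_x D(x) f(x) < 0`", a degree-`d` pseudo-density being `D : {0,1}^m → ℝ`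
  with `E_x D(x) = 1` and `E_x D(x) g(x)² ≥ 0` for every `g` of degree at most `d/2` (degree = degree
  as a multilinear polynomial; expectations uniform over the cube) — `IsPseudoDensity` below.
* **Theorem 3.8** (= Thm. 1.8 "Sum-of-squares degree vs. psd rank", quantitative part): "For any
  `m, d ≥ 1`, the following holds. Let `f : {0,1}^m → [0,1]` … Moreover, if there exists an
  `ε ∈ (0,1]`, and a degree-`d` pseudo-density `D : {0,1}^m → ℝ` with `E_x D(x) f(x) < -ε`, then for
  every `n ≥ 2m`, we have
  `rk_psd(M_n^f) ≥ ( c ε n / (d m² ‖D‖_∞ log n) )^{d/4} · (ε/‖D‖_∞)^{3/2} · √(E_x f(x))`,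
  where `c > 0` is a universal constant."  (Its first part — `1 + n^{1+d/2} ≥ rk_psd(M_n^f) ≥
  C_f (n/log n)^{d/4}` when `d + 2 = deg_sos(f)` — carries an authors' marginal note in the arXiv
  source about an off-by-one in `d` and is NOT vendored; the quantitative part is what Thm. 5.4 uses,
  with Grigoriev's knapsack pseudo-density of Thm. 5.3: `‖D‖_∞ ≤ m^{3/2}`, `ε = 1/(4m²)`, `d = m`.)
  The proof (Thm. 3.1: degree reduction by random restriction on the cube, psd-factorisation
  scaling, density-matrix approximation by quantum entropy) is not reproduced.

Also proved (second part of the file): LRS **Proposition 1.11** in factorisation form against the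
full `CORR_n` slack matrix of `LeeRaghavendraSteurer2015_thm11` (`HasPsdFactorization.patternMatrix_of_corrSlack`)
and the reduction `LeeRaghavendraSteurer2015_thm11_of_patternBound` (pattern-matrix bound for
nonnegative quadratic `f` at scale `2^{α n^{2/13}}` ⇒ Thm 1.1 as typed).

Rendering decisions. The cube `{0,1}^m` is `Fin m → Bool`; "degree `≤ k`" of `g : {0,1}^m → ℝ` is
"`g` agrees on the cube with SOME real polynomial of total degree `≤ k`" (`HasDegreeLE`; on the cube
this is the multilinear degree); `d/2` is natural-number division (`deg g ≤ ⌊d/2⌋`, as printed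
"`deg(g) ≤ d/2`"); `‖D‖_∞` enters through an arbitrary bound `K` with `|D x| ≤ K` for all `x` (the
printed bound is antitone in `‖D‖_∞`, so this is equivalent); `log` is `Real.log` (the base only
rescales the universal constant `c`); `x_S` uses `Finset.orderEmbOfFin`. No new notion is wider than
LRS's own.
-/

noncomputable section

open Finset Matrix
open scoped MatrixOrder

namespace Literature.Combinatorics.Optimization

/-! ### Functions on the discrete cube -/

/-- The 0/1 point of `ℝ^m` underlying a vertex `x ∈ {0,1}^m` of the cube. [cite: LeeRaghavendraSteurer2015, §2 (functions on the discrete cube)] -/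
def cubePoint {m : ℕ} (x : Fin m → Bool) : Fin m → ℝ := fun i => if x i then 1 else 0

/-- Uniform expectation over the cube: `E_x g(x) = 2^{-m} Σ_{x ∈ {0,1}^m} g(x)`. [cite: LeeRaghavendraSteurer2015, §2] -/
def cubeExpect {m : ℕ} (g : (Fin m → Bool) → ℝ) : ℝ := (∑ x, g x) / 2 ^ m

/-- `g : {0,1}^m → ℝ` has (multilinear) degree at most `k`: it agrees on the cube with a real
polynomial of total degree `≤ k`. [cite: LeeRaghavendraSteurer2015, §1 ("deg(g) denotes the degree of g as a multilinear polynomial")] -/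
def HasDegreeLE {m : ℕ} (k : ℕ) (g : (Fin m → Bool) → ℝ) : Prop :=
  ∃ P : MvPolynomial (Fin m) ℝ, P.totalDegree ≤ k ∧ ∀ x, MvPolynomial.eval (cubePoint x) P = g x

/-- A **degree-`d` pseudo-density** on `{0,1}^m`: `E_x D(x) = 1` and `E_x D(x) g(x)² ≥ 0` for every
`g` of degree at most `d/2`. [cite: LeeRaghavendraSteurer2015, §2 (pseudo-densities)] -/
def IsPseudoDensity {m : ℕ} (d : ℕ) (D : (Fin m → Bool) → ℝ) : Prop :=
  cubeExpect D = 1 ∧ ∀ g : (Fin m → Bool) → ℝ, HasDegreeLE (d / 2) g →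
    0 ≤ cubeExpect (fun x => D x * g x ^ 2)

/-- A **sum-of-squares certificate of degree `d`** for `f` on the cube: `f = Σ_i g_i²` pointwise on
`{0,1}^m` with every `deg g_i ≤ d/2` ("`deg_sos(f)` = the minimal such `d`"). [cite: LeeRaghavendraSteurer2015, §1 (Main theorem: sos certificate, sos degree)] -/
def HasSosCertificate {m : ℕ} (d : ℕ) (f : (Fin m → Bool) → ℝ) : Prop :=
  ∃ (k : ℕ) (g : Fin k → (Fin m → Bool) → ℝ), (∀ i, HasDegreeLE (d / 2) (g i)) ∧
    ∀ x, f x = ∑ i, g i x ^ 2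

/-! ### Pattern matrices and psd factorisations -/

/-- **The pattern matrix `M_n^f`** of `f : {0,1}^m → ℝ`: rows = `m`-subsets `S ⊆ [n]`, columns =
`x ∈ {0,1}ⁿ`, entry `f(x_S)` where `x_S` lists the coordinates of `x` in `S` in increasing order.
[cite: LeeRaghavendraSteurer2015, §1 (eq. (restriction), M_n^f(S,x) := f(x_S))] -/
def patternMatrix (n : ℕ) {m : ℕ} (f : (Fin m → Bool) → ℝ) :
    {S : Finset (Fin n) // S.card = m} → (Fin n → Bool) → ℝ :=
  fun S x => f fun j => x (S.1.orderEmbOfFin S.2 j)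

/-- `M` (a real matrix with rows `ι`, columns `κ`) has a **positive-semidefinite factorisation of
size `r`**: `M i j = Tr(A_i B_j)` with `A_i, B_j` real symmetric psd `r × r` matrices; `rk_psd(M)`
is the least such `r`. [cite: LeeRaghavendraSteurer2015, Def. 1.7] -/
def HasPsdFactorization {ι κ : Type*} (M : ι → κ → ℝ) (r : ℕ) : Prop :=
  ∃ (A : ι → Matrix (Fin r) (Fin r) ℝ) (B : κ → Matrix (Fin r) (Fin r) ℝ),
    (∀ i, (A i).PosSemidef) ∧ (∀ j, (B j).PosSemidef) ∧ ∀ i j, M i j = (A i * B j).trace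

/-! ### Elementary API -/

/-- The cube `{0,1}^m` has `2^m` points. [folklore] -/
private theorem card_cube (m : ℕ) : Fintype.card (Fin m → Bool) = 2 ^ m := by
  simp

/-- The uniform density `D ≡ 1` has expectation `1`. [cite: LeeRaghavendraSteurer2015, §2] -/
theorem cubeExpect_one (m : ℕ) : cubeExpect (fun _ : Fin m → Bool => (1 : ℝ)) = 1 := by
  simp only [cubeExpect, sum_const, card_univ, card_cube, nsmul_eq_mul, mul_one]
  rw [Nat.cast_pow, Nat.cast_ofNat, div_self (pow_ne_zero _ two_ne_zero)]

/-- Expectations of pointwise-nonnegative functions are nonnegative. [cite: LeeRaghavendraSteurer2015, §2] -/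
theorem cubeExpect_nonneg {m : ℕ} {g : (Fin m → Bool) → ℝ} (hg : ∀ x, 0 ≤ g x) :
    0 ≤ cubeExpect g :=
  div_nonneg (sum_nonneg fun x _ => hg x) (pow_nonneg zero_le_two _)

/-- Constants have degree `≤ k` for every `k`. [cite: LeeRaghavendraSteurer2015, §1] -/
theorem HasDegreeLE.const {m : ℕ} (k : ℕ) (a : ℝ) : HasDegreeLE k (fun _ : Fin m → Bool => a) :=
  ⟨MvPolynomial.C a, by simp, fun x => by simp⟩

/-- The uniform density `D ≡ 1` is a pseudo-density of every degree (the actual uniform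
distribution). [cite: LeeRaghavendraSteurer2015, §2 (pseudo-densities generalise densities)] -/
theorem isPseudoDensity_one (m d : ℕ) : IsPseudoDensity d (fun _ : Fin m → Bool => (1 : ℝ)) :=
  ⟨cubeExpect_one m, fun g _ => cubeExpect_nonneg fun x => by positivity⟩

/-- A pseudo-density cannot certify negativity of a function with a sum-of-squares certificate of
the same degree: `E_x D(x) f(x) ≥ 0` (the easy direction of "sos degree `> d` iff some degree-`d`
pseudo-density has `E D f < 0`"). [cite: LeeRaghavendraSteurer2015, §2] -/
theorem IsPseudoDensity.cubeExpect_mul_nonneg {m d : ℕ} {D f : (Fin m → Bool) → ℝ}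
    (hD : IsPseudoDensity d D) (hf : HasSosCertificate d f) :
    0 ≤ cubeExpect (fun x => D x * f x) := by
  obtain ⟨k, g, hg, hfx⟩ := hf
  have : (fun x => D x * f x) = fun x => ∑ i, D x * g i x ^ 2 := by
    funext x; rw [hfx x, mul_sum]
  rw [this, cubeExpect, sum_comm, sum_div]
  exact sum_nonneg fun i _ => hD.2 (g i) (hg i)

/-- Entries of the pattern matrix. [cite: LeeRaghavendraSteurer2015, §1 (eq. (restriction))] -/
@[simp] theorem patternMatrix_apply (n : ℕ) {m : ℕ} (f : (Fin m → Bool) → ℝ)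
    (S : {S : Finset (Fin n) // S.card = m}) (x : Fin n → Bool) :
    patternMatrix n f S x = f (fun j => x (S.1.orderEmbOfFin S.2 j)) := rfl

/-- `Tr(A B) ≥ 0` for real psd `A, B` (`Tr(A B) = Tr(A^{1/2} B A^{1/2})`). [folklore] -/
private theorem trace_mul_nonneg_of_posSemidef {r : ℕ} {A B : Matrix (Fin r) (Fin r) ℝ}
    (hA : A.PosSemidef) (hB : B.PosSemidef) : 0 ≤ (A * B).trace := by
  set S : Matrix (Fin r) (Fin r) ℝ := CFC.sqrt A with hS
  have hSpsd : S.PosSemidef := (CFC.sqrt_nonneg A).posSemidef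
  have hSS : S * S = A := CFC.sqrt_mul_sqrt_self A
  have hSH : Sᴴ = S := hSpsd.1
  have hM : (S * B * Sᴴ).PosSemidef := hB.mul_mul_conjTranspose_same S
  have htrM : (S * B * Sᴴ).trace = (A * B).trace := by
    rw [hSH, Matrix.mul_assoc, trace_mul_comm, Matrix.mul_assoc, hSS, trace_mul_comm]
  rw [← htrM]
  exact hM.trace_nonneg

/-- A matrix with a psd factorisation is entrywise nonnegative (`Tr(A B) ≥ 0` for psd `A, B`).
[cite: LeeRaghavendraSteurer2015, Def. 1.7 ("nonnegative matrix")] -/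
theorem HasPsdFactorization.nonneg {ι κ : Type*} {M : ι → κ → ℝ} {r : ℕ}
    (h : HasPsdFactorization M r) (i : ι) (j : κ) : 0 ≤ M i j := by
  obtain ⟨A, B, hA, hB, hM⟩ := h
  rw [hM i j]
  exact trace_mul_nonneg_of_posSemidef (hA i) (hB j)

/-! ### The named fact -/

/-- **Lee–Raghavendra–Steurer 2015, Theorem 3.8 (quantitative part; = Thm. 1.8 "Sum-of-squares
degree vs. psd rank").** There is a universal constant `c > 0` such that: for all `m, d ≥ 1`, every
`f : {0,1}^m → [0,1]`, every `ε ∈ (0,1]` and every degree-`d` pseudo-density `D` on `{0,1}^m` with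
`E_x D(x) f(x) < -ε` and `‖D‖_∞ ≤ K`, for every `n ≥ 2m` the pattern matrix `M_n^f(S,x) = f(x_S)`
(`|S| = m`, `x ∈ {0,1}ⁿ`) satisfies
`rk_psd(M_n^f) ≥ ( c ε n / (d m² K log n) )^{d/4} · (ε/K)^{3/2} · √(E_x f(x))`,
i.e. it has no positive-semidefinite factorisation of any size `r` below that number. (Printed with
`K = ‖D‖_∞`; the bound is antitone in `K`.) Used with Grigoriev's knapsack pseudo-density
(Thm. 5.3) it gives `rk_psd(CORR_n) ≥ 2^{α n^{2/13}}` (`LeeRaghavendraSteurer2015_thm11`).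
[cite: LeeRaghavendraSteurer2015, Thm. 3.8] -/
def LeeRaghavendraSteurer2015_thm38 : Prop :=
  ∃ c : ℝ, 0 < c ∧
    ∀ (m d : ℕ), 1 ≤ m → 1 ≤ d →
    ∀ (f : (Fin m → Bool) → ℝ), (∀ x, 0 ≤ f x ∧ f x ≤ 1) →
    ∀ (ε : ℝ), 0 < ε → ε ≤ 1 →
    ∀ (D : (Fin m → Bool) → ℝ) (K : ℝ), IsPseudoDensity d D → (∀ x, |D x| ≤ K) →
      cubeExpect (fun x => D x * f x) < -ε →
    ∀ n : ℕ, 2 * m ≤ n → ∀ r : ℕ,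
      (r : ℝ) < (c * ε * n / (d * (m : ℝ) ^ 2 * K * Real.log n)) ^ ((d : ℝ) / 4) *
          (ε / K) ^ ((3 : ℝ) / 2) * Real.sqrt (cubeExpect f) →
      ¬ HasPsdFactorization (patternMatrix n f) r

/-! ### LRS Proposition 1.11: quadratic pattern matrices are submatrices of the slack matrix of `CORR_n`

"If `f : {0,1}^m → ℝ_{≥0}` is a nonnegative quadratic function over `{0,1}^m`, then for any `n ≥ m`, the
matrix `M_n^f` is a submatrix of some slack matrix associated to `CORR_n`" (LRS Prop. 1.11 = Prop. 5.1,
proof in §5: row `S` ↦ the valid inequality `⟨A_S, X⟩ ≤ b` obtained by planting the coefficient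
matrix of `f` on the coordinates `S × S`; column `x` ↦ the vertex `x xᵀ`). Proved here against the
FULL slack matrix of `CORR_n` exactly as it is typed in `LeeRaghavendraSteurer2015_thm11`
(sibling file), so that a psd factorisation of that slack matrix of size `r` yields one of `M_n^f`
(`HasPsdFactorization.patternMatrix_of_corrSlack`), and consequently a pattern-matrix psd-rank lower
bound at the scale `2^{α n^{2/13}}` for nonnegative quadratic `f` (what Thm 3.8 + Thm 5.3 deliver in
print) implies `LeeRaghavendraSteurer2015_thm11` (`LeeRaghavendraSteurer2015_thm11_of_patternBound`)
— the printed route Prop 1.11 + Thm 3.8 + Thm 5.3 ⇒ Thm 1.1, with the two analytic inputs left as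
the hypothesis. -/

/-- A function on the cube `{0,1}^m` of (multilinear) degree `≤ 2`, in the normal form
`f(x) = b − Σ_{i,j} A_{ij} x_i x_j` (on 0/1 points the linear terms are absorbed into the diagonal,
`x_i = x_i²`). [cite: LeeRaghavendraSteurer2015, Prop. 1.11 ("nonnegative quadratic function over {0,1}^m")] -/
def IsCubeQuadratic {m : ℕ} (f : (Fin m → Bool) → ℝ) : Prop :=
  ∃ (A : Matrix (Fin m) (Fin m) ℝ) (b : ℝ),
    ∀ x, f x = b - ∑ i, ∑ j, A i j * (cubePoint x i * cubePoint x j)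

/-- A vertex of the cube as a 0/1 point of `ℝⁿ` — an element of the column index type of the full
slack matrix of `CORR_n` in `LeeRaghavendraSteurer2015_thm11`. [cite: LeeRaghavendraSteurer2015, §1.1 (CORR_n = conv{x xᵀ : x ∈ {0,1}ⁿ})] -/
def cubeVertex {n : ℕ} (x : Fin n → Bool) : {x : Fin n → ℝ // ∀ i, x i = 0 ∨ x i = 1} :=
  ⟨cubePoint x, fun i => by unfold cubePoint; split_ifs <;> simp⟩

/-- Transport of an `m × m` coefficient matrix to the coordinates of an `m`-subset
`S = {e 0 < ⋯ < e (m-1)} ⊆ [n]` (zero outside `S × S`). [cite: LeeRaghavendraSteurer2015, Prop. 1.11 (proof, §5)] -/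
def liftMatrix {n m : ℕ} (e : Fin m ↪o Fin n) (A : Matrix (Fin m) (Fin m) ℝ) :
    Matrix (Fin n) (Fin n) ℝ :=
  fun p q => ∑ i, ∑ j, if e i = p ∧ e j = q then A i j else 0

/-- Indicator double sums collapse onto the image point. [folklore] -/
private theorem sum_sum_ite_and_eq {n m : ℕ} (e : Fin m ↪o Fin n) (i j : Fin m)
    (g : Fin n → Fin n → ℝ) :
    ∑ p, ∑ q, (if e i = p ∧ e j = q then g p q else 0) = g (e i) (e j) := by
  simp_rw [ite_and]
  rw [Finset.sum_eq_single (e i) (fun p _ hp => by simp [Ne.symm hp]) (by simp)]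
  simp

/-- The lifted quadratic form evaluates on `y ∈ ℝⁿ` to the original form on `y ∘ e`.
[cite: LeeRaghavendraSteurer2015, Prop. 1.11 (proof, §5)] -/
theorem sum_liftMatrix {n m : ℕ} (e : Fin m ↪o Fin n) (A : Matrix (Fin m) (Fin m) ℝ)
    (y : Fin n → ℝ) :
    ∑ p, ∑ q, liftMatrix e A p q * (y p * y q) = ∑ i, ∑ j, A i j * (y (e i) * y (e j)) := by
  let F : Fin m → Fin m → Fin n → Fin n → ℝ :=
    fun i j p q => if e i = p ∧ e j = q then A i j * (y p * y q) else 0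
  have step : ∀ p q : Fin n, liftMatrix e A p q * (y p * y q) = ∑ i, ∑ j, F i j p q := by
    intro p q
    unfold liftMatrix
    rw [sum_mul]
    refine sum_congr rfl fun i _ => ?_
    rw [sum_mul]
    refine sum_congr rfl fun j _ => ?_
    simp only [F]
    split_ifs <;> simp
  simp_rw [step]
  calc ∑ p, ∑ q, ∑ i, ∑ j, F i j p q
      = ∑ p, ∑ i, ∑ q, ∑ j, F i j p q := by
        refine sum_congr rfl fun p _ => ?_
        exact Finset.sum_comm
    _ = ∑ i, ∑ p, ∑ q, ∑ j, F i j p q := Finset.sum_comm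
    _ = ∑ i, ∑ p, ∑ j, ∑ q, F i j p q := by
        refine sum_congr rfl fun i _ => sum_congr rfl fun p _ => ?_
        exact Finset.sum_comm
    _ = ∑ i, ∑ j, ∑ p, ∑ q, F i j p q := by
        refine sum_congr rfl fun i _ => ?_
        exact Finset.sum_comm
    _ = ∑ i, ∑ j, A i j * (y (e i) * y (e j)) := by
        refine sum_congr rfl fun i _ => sum_congr rfl fun j _ => ?_
        exact sum_sum_ite_and_eq e i j (fun p q => A i j * (y p * y q))

/-- **LRS Proposition 1.11, factorisation form.** A positive-semidefinite factorisation of size `r`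
of the full slack matrix of `CORR_n` (rows: all valid inequalities `Σ c_{ij} x_i x_j ≤ b` on
`{0,1}ⁿ`; columns: all `x ∈ {0,1}ⁿ`; exactly the shape negated in `LeeRaghavendraSteurer2015_thm11`)
restricts to one of the pattern matrix `M_n^f` of every nonnegative quadratic `f : {0,1}^m → ℝ`:
row `S` is the valid inequality with coefficient matrix `A` planted on `S × S` and right-hand side
`b` (valid because `f ≥ 0`), column `x` is the vertex `x xᵀ`. [cite: LeeRaghavendraSteurer2015, Prop. 1.11 (= Prop. 5.1)] -/
theorem HasPsdFactorization.patternMatrix_of_corrSlack {n m r : ℕ} {f : (Fin m → Bool) → ℝ}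
    (hq : IsCubeQuadratic f) (hf : ∀ x, 0 ≤ f x)
    (U : {cb : Matrix (Fin n) (Fin n) ℝ × ℝ //
            ∀ x : Fin n → ℝ, (∀ i, x i = 0 ∨ x i = 1) →
              ∑ i, ∑ j, cb.1 i j * (x i * x j) ≤ cb.2} → Matrix (Fin r) (Fin r) ℝ)
    (V : {x : Fin n → ℝ // ∀ i, x i = 0 ∨ x i = 1} → Matrix (Fin r) (Fin r) ℝ)
    (hU : ∀ cb, (U cb).PosSemidef) (hV : ∀ x, (V x).PosSemidef)
    (hfac : ∀ cb x, cb.1.2 - ∑ i, ∑ j, cb.1.1 i j * (x.1 i * x.1 j) = (U cb * V x).trace) :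
    HasPsdFactorization (patternMatrix n f) r := by
  obtain ⟨A, b, hfx⟩ := hq
  have valid : ∀ S : {S : Finset (Fin n) // S.card = m}, ∀ y : Fin n → ℝ,
      (∀ i, y i = 0 ∨ y i = 1) →
      ∑ p, ∑ q, liftMatrix (S.1.orderEmbOfFin S.2) A p q * (y p * y q) ≤ b := by
    intro S y hy
    rw [sum_liftMatrix]
    set e := S.1.orderEmbOfFin S.2
    let z : Fin m → Bool := fun i => decide (y (e i) = 1)
    have hz : ∀ i, cubePoint z i = y (e i) := by
      intro i
      rcases hy (e i) with h | h <;> simp [cubePoint, z, h]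
    have h0 := hf z
    rw [hfx z] at h0
    simp_rw [hz] at h0
    linarith
  refine ⟨fun S => U ⟨(liftMatrix (S.1.orderEmbOfFin S.2) A, b), valid S⟩,
    fun x => V (cubeVertex x), fun S => hU _, fun x => hV _, fun S x => ?_⟩
  rw [← hfac, patternMatrix_apply, hfx, sum_liftMatrix]
  rfl

/-- **The printed route to LRS Theorem 1.1, modulo its analytic inputs**: a psd-rank lower bound
for pattern matrices of nonnegative QUADRATIC cube functions at the scale `2^{α n^{2/13}}` (what
Thm 3.8 with Grigoriev's knapsack pseudo-density, Thm 5.3, yields in print) implies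
`LeeRaghavendraSteurer2015_thm11` — by Proposition 1.11 (`HasPsdFactorization.patternMatrix_of_corrSlack`).
[cite: LeeRaghavendraSteurer2015, Thm. 5.4 (proof: Prop. 1.11 + Thm. 3.8 + Thm. 5.3)] -/
theorem LeeRaghavendraSteurer2015_thm11_of_patternBound
    (h : ∃ α : ℝ, 0 < α ∧ ∀ n : ℕ, 1 ≤ n → ∀ r : ℕ,
      (r : ℝ) < (2 : ℝ) ^ (α * (n : ℝ) ^ ((2 : ℝ) / 13)) →
        ∃ (m : ℕ) (f : (Fin m → Bool) → ℝ), IsCubeQuadratic f ∧ (∀ x, 0 ≤ f x) ∧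
          ¬ HasPsdFactorization (patternMatrix n f) r) :
    LeeRaghavendraSteurer2015_thm11 := by
  obtain ⟨α, hα, H⟩ := h
  refine ⟨α, hα, fun n hn r hr => ?_⟩
  obtain ⟨m, f, hq, hf, hnot⟩ := H n hn r hr
  rintro ⟨U, V, hU, hV, hfac⟩
  exact hnot (HasPsdFactorization.patternMatrix_of_corrSlack hq hf U V hU hV hfac)

end Literature.Combinatorics.Optimization
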